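import Mathlib.AlgebraicGeometry.ProjectiveSpectrum.Basic
import Mathlib.AlgebraicGeometry.AffineScheme
import HarnessLib

/-!
# Sections of `Proj A` over `D₊(f)` versus the chart ring `(A_f)₀`: the primes correspond

Support file for crux stmt-ResolutionOfSingularities-15315
(`FrobeniusLadder.FInjectiveMacaulayfication`, line `Sketch`, seat c5): stub
`stub_projBasicOpenSections`.

The crux's blow-up engine speaks about the ring of sections `Γ(X₁, U)` of an affine open `U` of
a scheme `X₁` and the primes `primeIdealOf y` of its points `y : U`, while the chart
computations for `X₁ = Proj A` (`A` a graded algebra, e.g. a Rees algebra) live in the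
degree-zero localizations `(A_f)₀ = HomogeneousLocalization.Away 𝒜 f` and their open
immersions `awayι : Spec (A_f)₀ ⟶ Proj A` with image `D₊(f)`. This file is the dictionary
between the two: there is a ring isomorphism `e : Γ(Proj A, D₊(f)) ≃+* (A_f)₀` such that for
every prime `q` of `(A_f)₀` the point `y = awayι q` of `D₊(f)` has `primeIdealOf y = e⁻¹(q)`.

Proof: take `e` to be the inverse of Mathlib's `basicOpenIsoAway : (A_f)₀ ≅ Γ(Proj A, D₊(f))`
(the canonical map `awayToSection`). By construction the chart isomorphism
`basicOpenIsoSpec : D₊(f) ≅ Spec (A_f)₀` is `D₊(f).toSpecΓ ≫ Spec (awayToSection)`, and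
`primeIdealOf` is the underlying map of `D₊(f).toSpecΓ : D₊(f) ⟶ Spec Γ(Proj A, D₊(f))`;
hence `D₊(f).toSpecΓ = basicOpenIsoSpec.hom ≫ Spec (awayToSection⁻¹)`, and evaluating at the
point `basicOpenIsoSpec.inv q` (which is `y`, as `awayι = basicOpenIsoSpec.inv ≫ ι`) gives
`primeIdealOf y = Spec (awayToSection⁻¹) q = comap e q`.

References: The Stacks Project, Tag 01MB (`D₊(f) ≅ Spec A_(f)` for `Proj`). [StacksProject]
Everything here is folklore bookkeeping over Mathlib's `AlgebraicGeometry.Proj` API; no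
definition is declared.
-/

-- single-problem summit: the doubled namespace component `ResolutionOfSingularities` is forced
set_option linter.dupNamespace false

noncomputable section

namespace Summit.ResolutionOfSingularities.ResolutionOfSingularities.Theorems.FInjectiveMacaulayfication.ProjBasicOpenSections

open AlgebraicGeometry CategoryTheory

/-- For a homogeneous element `f` of positive degree of a graded algebra `A`, the canonical map
`D₊(f).toSpecΓ : D₊(f) ⟶ Spec Γ(Proj A, D₊(f))` (whose underlying map is `primeIdealOf`)
factors as the chart isomorphism `basicOpenIsoSpec : D₊(f) ≅ Spec (A_f)₀` followed by `Spec` of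
the inverse of `basicOpenIsoAway : (A_f)₀ ≅ Γ(Proj A, D₊(f))`.
[cite: StacksProject, Tag 01MB] -/
theorem isoSpec_hom_eq {R A : Type} [CommRing R] [CommRing A] [Algebra R A]
    (𝒜 : ℕ → Submodule R A) [GradedAlgebra 𝒜] (f : A) {m : ℕ} (hf : f ∈ 𝒜 m) (hm : 0 < m) :
    (Proj.isAffineOpen_basicOpen 𝒜 f hf hm).isoSpec.hom =
      (Proj.basicOpenIsoSpec 𝒜 f hf hm).hom ≫
        Spec.map (Proj.basicOpenIsoAway 𝒜 f hf hm).inv := by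
  rw [IsAffineOpen.isoSpec_hom, Proj.basicOpenIsoSpec_hom, Proj.basicOpenToSpec,
    Category.assoc, ← Spec.map_comp, ← Proj.basicOpenIsoAway_hom 𝒜 f hf hm, Iso.inv_hom_id,
    Spec.map_id, Category.comp_id]

/-- **Sections of `Proj A` over `D₊(f)` versus the chart ring `(A_f)₀`.** For a homogeneous
element `f` of positive degree there is a ring isomorphism `e : Γ(Proj A, D₊(f)) ≃+* (A_f)₀`
(the inverse of the canonical `awayToSection`) such that, for every prime `q` of `(A_f)₀`, the
point `awayι q` of the affine open `D₊(f)` has `primeIdealOf = e⁻¹(q)`.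
[cite: StacksProject, Tag 01MB] -/
theorem stub_projBasicOpenSections : ∀ (R A : Type) [CommRing R] [CommRing A] [Algebra R A]
    (𝒜 : ℕ → Submodule R A) [GradedAlgebra 𝒜] (f : A) (m : ℕ) (hf : f ∈ 𝒜 m) (hm : 0 < m),
    ∃ e : Γ(Proj 𝒜, Proj.basicOpen 𝒜 f) ≃+* HomogeneousLocalization.Away 𝒜 f,
      ∀ (y : Proj.basicOpen 𝒜 f) (q : PrimeSpectrum (HomogeneousLocalization.Away 𝒜 f)),
        (Proj.awayι 𝒜 f hf hm).base q = y.1 →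
        ((Proj.isAffineOpen_basicOpen 𝒜 f hf hm).primeIdealOf y).asIdeal = q.asIdeal.comap e.toRingHom := by
  intro R A _ _ _ 𝒜 _ f m hf hm
  refine ⟨(Proj.basicOpenIsoAway 𝒜 f hf hm).symm.commRingCatIsoToRingEquiv, fun y q hq => ?_⟩
  -- the point `y` of `D₊(f)` is the image of `q` under the chart isomorphism
  have hy : y = (Proj.basicOpenIsoSpec 𝒜 f hf hm).inv q := by
    apply Subtype.ext
    rw [← hq, ← Proj.basicOpenIsoSpec_inv_ι, Scheme.Hom.comp_apply, Scheme.Opens.ι_apply]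
  -- hence `primeIdealOf y = toSpecΓ (basicOpenIsoSpec.inv q) = Spec (awayToSection⁻¹) q`
  have key : (Proj.isAffineOpen_basicOpen 𝒜 f hf hm).primeIdealOf y =
      Spec.map (Proj.basicOpenIsoAway 𝒜 f hf hm).inv q := by
    rw [IsAffineOpen.primeIdealOf, hy, isoSpec_hom_eq, Scheme.Hom.comp_apply,
      Scheme.inv_hom_apply]
  rw [key, Spec.map_apply]
  rfl

end Summit.ResolutionOfSingularities.ResolutionOfSingularities.Theorems.FInjectiveMacaulayfication.ProjBasicOpenSections

end
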